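/-
Copyright (c) 2026 the pub-hodgecm-mathlib formalisation cell (harness21).  Prover seat hodgecm-mathlib-LH7-p03 (g3): line LH7 (closer row `stub_PKtupleK2`, #181 III-127;
h413 = stmt-HodgeConjecture-24833), leaf ED. 3 road «H-SIDE CONSTRUCTION ROWS», glue (γ) O6; 2026-09-02.
-/
import Summits.HodgeConjecture.HodgeConjecture.Theorems.F0P3cPKtupleU1Line              -- ★ (γ′) `forall_eq_of_cmOccursInDiscreteSpectrum_of_eventually_eq`, `xiLocalChar_comp_inl`, `isAutomorphic_eta_mul_psi`; brings ★ (β) `PKsaU2Shape`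
import Summits.HodgeConjecture.HodgeConjecture.Theorems.F0P3SpectralPacketXiHSigned       -- ★ `SpectralPacketH` (3g), `LocalPacketKit.memH`, `GlobalPacketH.loc`
import Literature.NumberTheory.Automorphic.IrreducibleClassesBoxCharRigidity              -- ★ (α′) `IrrClass.boxChar_eq_boxChar_iff`, `mk_ofChar_eq_boxChar`, `eq_of_boxChar_mem_singleton`, `isOpen_ker_comp_inl∕inr`
import Literature.NumberTheory.Automorphic.TorusCharacterRigidityCofinite                 -- ★ `torusCharacter_eq_of_torusLocalComponent_eq_of_not_mem` (Tate density on the norm-one torus)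
import Literature.NumberTheory.Automorphic.LocalNormOneHilbert90                          -- ★ `localDet_two_surjective` (local Hilbert 90)
import HarnessLib

/-!
# LH7 (γ) GLUE O6 — «(KR-2) DERIVED»: a `DiscH`-discrete `H`-packet that is the character packet `{⟦ξ_v⟧}` off a finite set is `{⟦ξ_v⟧}` everywhere,
# from the realisation row (KD4-H), the local row (KR-1′), strong approximation on `U(Φ₂)` (O8a ★ `PKsaU2Shape`) and the ★ `U(1)` line

Cell `hodgecm-mathlib` (D-0151), crux H413 = `stmt-HodgeConjecture-24833`, line LH7 (closer row `stub_PKtupleK2 : PKtupleLetterK2` of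
`Cruxes/H413/Lines/F0_U3LettersRung1.lean`), leaf `Cruxes/H413/Lines/F0_P3c_PKtuplePaydown.lean` ED. 2 (2a18f6c5), banked road «leaf ED. 3, H-SIDE CONSTRUCTION
ROWS» (LH7-plan (g2) `MEMO-ED3.v2` §1∕§3 (γ); typed rows LH7-plan (g3) fit v4 f9c2a731; statement layer ★ p849785 `Theorems/F0P3cPKtupleHSideLetters`; (α′) ★ p849759;
(γ′) ★ p849966∕p849979 `Theorems/F0P3cPKtupleU1Line`).  THEOREMS ONLY (kernel lane): no `def`, no instance, no notation, no named fact, no `sorry`; `--supports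
stmt-HodgeConjecture-24833`; closes no stub.  In the leaf ED. 3 the posited row (KR-2) of organ O1′ (ED. 2 :192) LEAVES the print core and is re-obtained from this file
(tied by import like O3∕O4∕O5), its hypotheses being the IN-∃ construction rows (KD4-H), (KR-1′) of O1″ and the PRINT S organ O8a.

THE MATHEMATICS ([Rogawski1990] §13.3 pp. 202–203).  Let `ρ` be a `DiscH`-discrete `H`-packet (`H = U(Φ₂) × U(Φ₁)`) with member sets `{⟦ξ_v⟧}` off a finite set `Sρ`.
(KD4-H) realises `ρ` in `L²_disc(U(Φ₂)) ⊗ L²_disc(U(Φ₁))`: there are a family `π₂ = (π₂,v)_v` of classes of the `U(Φ₂)(L⁺_v)` occurring in the discrete spectrum of `μ₂`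
and a smooth character family `χ₁` of the `U(Φ₁)(L⁺_v)` occurring in that of `μ₁` with `π₂,v ⊠ χ₁,v ∈ ρ_v` for every finite `v`.  Off `Sρ` the member is the character
class `⟦ξ_v⟧`, so (★ (α′) joint rigidity of `⊠`) `π₂,v = ⟦ξ_v|_{U(Φ₂)}⟧` and `χ₁,v = ξ_v|_{U(Φ₁)} = ψ_v ∘ det`.  On `U(Φ₁)` the ★ `U(1)` line gives `χ₁,v = ξ_v|_{U(Φ₁)}`
EVERYWHERE (multiplicity one + Tate density).  On `U(Φ₂)` strong approximation for `SU(Φ₂)` (O8a) makes `π₂,v = ⟦θ_v ∘ det₀⟧` at every `v` for ONE automorphic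
character `θ` of the norm-one torus; off `Sρ`, `θ_v ∘ det₀ = (η ψ)_v ∘ det₀` (★ `xiLocalChar_comp_inl`), `det₀` is onto (local Hilbert 90, ★ `localDet_two_surjective`),
so `θ_v = (η ψ)_v` off `Sρ` and `θ = η ψ` (★ rigidity of automorphic torus characters off a finite set); hence `π₂,v = ⟦ξ_v|_{U(Φ₂)}⟧` EVERYWHERE.  Therefore
`π₂,v ⊠ χ₁,v = ⟦ξ_v⟧ ∈ ρ_v` at every `v` (★ (L4) `mk_ofChar_eq_boxChar`), and (KR-1′) «a packet containing `⟦ξ_v⟧` is `{⟦ξ_v⟧}`» concludes.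

CONTENTS (namespace `…Cruxes.H413.F0P3cPKtupleKR2OfKD4H`): §1 `torusLocalComponent_eq_of_mk_ofChar_comp_localDet_eq` (cancel `det₀`),
`forall_pi₂_eq_of_pKsaU2Shape_of_forall_not_mem` (the `U(Φ₂)` twin of ★ `forall_eq_of_cmOccursInDiscreteSpectrum_of_eventually_eq`, modulo O8a);
§2 `boxChar_eq_mk_xiLocalChar` (the member `⟦ξ_v|_{U(Φ₂)}⟧ ⊠ ξ_v|_{U(Φ₁)}` is `⟦ξ_v⟧`); §3 **`memH_loc_eq_singleton_of_KD4H`** and its row-shaped form **`KR2_of_KD4H`**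
(conclusion = the leaf՚s (KR-2) row text token for token).
HONEST LABEL: HC_CM is proved only modulo the 7 printed citations (2 remaining: hLiu418 = stmt-HodgeConjecture-24832, h413 = stmt-HodgeConjecture-24833) until
rung 0 closes; this file is count-neutral in-house glue (it moves the print content of (KR-2) onto O8a + the construction rows).

## References
* [Rogawski1990] J. D. Rogawski, *Automorphic Representations of Unitary Groups in Three Variables*, Ann. of Math. Stud. 123 (1990), §12.1 p. 171, §13.1 p. 199,
  §13.3 Thms. 13.3.2∕13.3.4∕13.3.5 pp. 202–203.
* [PlatonovRapinchuk1994] V. Platonov, A. Rapinchuk, *Algebraic Groups and Number Theory* (1994), §7.4 Thm. 7.12 p. 427; §7.3 Prop. 7.8.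
* [CasselsFrohlichANT1967] J. W. S. Cassels, A. Fröhlich (eds.), *Algebraic Number Theory* (1967), Ch. VII (Tate) §4 Prop. 4.1.
* [BushnellHenniart2006] C. J. Bushnell, G. Henniart, *The Local Langlands Conjecture for GL(2)* (2006), §9.1.
-/

set_option autoImplicit false
-- the mandated namespace repeats the single-problem summit's segment (`HodgeConjecture.HodgeConjecture`)
set_option linter.dupNamespace false

noncomputable section

namespace Summit.HodgeConjecture.HodgeConjecture.Cruxes.H413.F0P3cPKtupleKR2OfKD4H

open MeasureTheory NumberField IsDedekindDomain
open Literature.NumberTheory.Automorphic Literature.NumberTheory.Automorphic.UnitaryGroup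
open Literature.NumberTheory.Rogawski1990 Literature.NumberTheory.GaloisRepresentations
open Literature.NumberTheory.Automorphic.Arthur2013.Leaves.TECR
open Summit.HodgeConjecture.HodgeConjecture.Cruxes.H413.F0P3LocalPacketKit
open Summit.HodgeConjecture.HodgeConjecture.Cruxes.H413.F0P3ArchPacketKit
open Summit.HodgeConjecture.HodgeConjecture.Cruxes.H413.F0P3GlobalPacket
open Summit.HodgeConjecture.HodgeConjecture.Cruxes.H413.F0P3SpectralPacket
open Summit.HodgeConjecture.HodgeConjecture.Cruxes.H413.F0P3GlobalPacketDiscrete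
open Summit.HodgeConjecture.HodgeConjecture.Cruxes.H413.F0P3cPKtupleHSideLetters
open Summit.HodgeConjecture.HodgeConjecture.Cruxes.H413.F0P3cPKtupleU1Line

variable {L : Type} [Field L] [NumberField L] [IsCMField L]

/-! ## §1 The `U(Φ₂)`-side: cancel `det₀`, then globalise with O8a and torus-character rigidity -/

/-- **Cancel `det₀`**: if `⟦ℂ_(θ_v ∘ det₀)⟧ = ⟦ℂ_(ξ_v ∘ inl)⟧` in `Irr(U(Φ₂)(L⁺_v))` then `θ_v = (η ψ)_v` on the local norm-one torus — `ξ_v ∘ inl = (η ψ)_v ∘ det₀`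
(★ `xiLocalChar_comp_inl`) and `det₀ : U(Φ₂)(L⁺_v) → E¹_v` is onto (★ `localDet_two_surjective`, local Hilbert 90). [cite: Rogawski1990, §13.3 p. 202; §1.9–§1.10 pp. 8–9] -/
theorem torusLocalComponent_eq_of_mk_ofChar_comp_localDet_eq (ξ : OneDimAutRepH L) (v : HeightOneSpectrum (𝓞 ↥(maximalRealSubfield L)))
    (θ : ↥(TorusDict.torus (IsCMField.complexConj L)) →ₜ* ℂˣ)
    (hk : IsOpen (((((torusLocalComponent L (IsCMField.complexConj L) v θ).comp (localDet (IsCMField.complexConj L) v (isUnit_antidiagOne_det L 2))).ker : Subgroup ↥(«local» L (IsCMField.complexConj L) 2 (Matrix.of fun i j : Fin 2 => if i.val + j.val + 1 = 2 then (1 : L) else 0) v)) : Set ↥(«local» L (IsCMField.complexConj L) 2 (Matrix.of fun i j : Fin 2 => if i.val + j.val + 1 = 2 then (1 : L) else 0) v))))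
    (h : IrrClass.mk (SmoothIrrep.ofChar ((torusLocalComponent L (IsCMField.complexConj L) v θ).comp (localDet (IsCMField.complexConj L) v (isUnit_antidiagOne_det L 2))) hk) = IrrClass.mk (SmoothIrrep.ofChar ((ξ.xiLocalChar v).comp (MonoidHom.inl ((cmDatum L 2 (Matrix.of fun i j : Fin 2 => if i.val + j.val + 1 = 2 then (1 : L) else 0)).Local v) ((cmDatum L 1 (Matrix.of fun i j : Fin 1 => if i.val + j.val + 1 = 1 then (1 : L) else 0)).Local v))) (IrrClass.isOpen_ker_comp_inl (F0P3XiLocalCharOpenKernel.isOpen_ker_xiLocalChar L ξ v)))) :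
    (torusLocalComponent L (IsCMField.complexConj L) v θ) = (torusLocalComponent L (IsCMField.complexConj L) v (ξ.η * ξ.ψ)) := by
  have h1 : (torusLocalComponent L (IsCMField.complexConj L) v θ).comp (localDet (IsCMField.complexConj L) v (isUnit_antidiagOne_det L 2)) = (torusLocalComponent L (IsCMField.complexConj L) v (ξ.η * ξ.ψ)).comp (localDet (IsCMField.complexConj L) v (isUnit_antidiagOne_det L 2)) :=
    ((IrrClass.mk_ofChar_eq_mk_ofChar_iff hk (IrrClass.isOpen_ker_comp_inl (F0P3XiLocalCharOpenKernel.isOpen_ker_xiLocalChar L ξ v))).1 h).trans (xiLocalChar_comp_inl ξ v)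
  refine MonoidHom.ext fun t => ?_
  obtain ⟨g, rfl⟩ := localDet_two_surjective L v t
  exact DFunLike.congr_fun h1 g

/-- **The `U(Φ₂)` twin of ★ `forall_eq_of_cmOccursInDiscreteSpectrum_of_eventually_eq`, MODULO O8a**: a family `π₂` of classes of the `U(Φ₂)(L⁺_v)` occurring in the
discrete spectrum of `μ₂` and equal to the character class `⟦ξ_v|_{U(Φ₂)}⟧` off a finite set `Sρ` is `⟦ξ_v|_{U(Φ₂)}⟧` at EVERY finite place: O8a (★ `PKsaU2Shape`, strong
approximation for `SU(Φ₂)`) gives one automorphic `θ` with `π₂,v = ⟦θ_v ∘ det₀⟧` for all `v`; off `Sρ` §1 gives `θ_v = (η ψ)_v`, so `θ = η ψ` (★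
`torusCharacter_eq_of_torusLocalComponent_eq_of_not_mem`), whence the identity everywhere. [cite: Rogawski1990, §13.3 Thm. 13.3.5 p. 202, p. 203]
[cite: PlatonovRapinchuk1994, §7.4 Thm. 7.12 p. 427] [cite: CasselsFrohlichANT1967, Ch. VII §4 Prop. 4.1 (proof)] -/
theorem forall_pi₂_eq_of_pKsaU2Shape_of_forall_not_mem (hsa : PKsaU2Shape L) {μ₂ : Measure (adelicGroupData (↥(maximalRealSubfield L)) L (IsCMField.complexConj L) 2 (Matrix.of fun i j : Fin 2 => if i.val + j.val + 1 = 2 then (1 : L) else 0)).automorphicQuotient} [(adelicGroupData (↥(maximalRealSubfield L)) L (IsCMField.complexConj L) 2 (Matrix.of fun i j : Fin 2 => if i.val + j.val + 1 = 2 then (1 : L) else 0)).IsAutomorphicMeasure μ₂]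
    (π₂ : ∀ v : HeightOneSpectrum (𝓞 ↥(maximalRealSubfield L)), IrrClass ((cmDatum L 2 (Matrix.of fun i j : Fin 2 => if i.val + j.val + 1 = 2 then (1 : L) else 0)).Local v))
    (hocc : cmOccursInDiscreteSpectrum L 2 (Matrix.of fun i j : Fin 2 => if i.val + j.val + 1 = 2 then (1 : L) else 0) μ₂ π₂) (ξ : OneDimAutRepH L) (Sρ : Finset (HeightOneSpectrum (𝓞 ↥(maximalRealSubfield L))))
    (hoff : ∀ v : HeightOneSpectrum (𝓞 ↥(maximalRealSubfield L)), v ∉ Sρ → π₂ v = IrrClass.mk (SmoothIrrep.ofChar ((ξ.xiLocalChar v).comp (MonoidHom.inl ((cmDatum L 2 (Matrix.of fun i j : Fin 2 => if i.val + j.val + 1 = 2 then (1 : L) else 0)).Local v) ((cmDatum L 1 (Matrix.of fun i j : Fin 1 => if i.val + j.val + 1 = 1 then (1 : L) else 0)).Local v))) (IrrClass.isOpen_ker_comp_inl (F0P3XiLocalCharOpenKernel.isOpen_ker_xiLocalChar L ξ v)))) :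
    ∀ v : HeightOneSpectrum (𝓞 ↥(maximalRealSubfield L)), π₂ v = IrrClass.mk (SmoothIrrep.ofChar ((ξ.xiLocalChar v).comp (MonoidHom.inl ((cmDatum L 2 (Matrix.of fun i j : Fin 2 => if i.val + j.val + 1 = 2 then (1 : L) else 0)).Local v) ((cmDatum L 1 (Matrix.of fun i j : Fin 1 => if i.val + j.val + 1 = 1 then (1 : L) else 0)).Local v))) (IrrClass.isOpen_ker_comp_inl (F0P3XiLocalCharOpenKernel.isOpen_ker_xiLocalChar L ξ v))) := by
  -- O8a: one automorphic `θ` with `π₂ v = ⟦θ_v ∘ det₀⟧` everywhere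
  obtain ⟨θ, hθ, hk, hπ⟩ := hsa μ₂ π₂ hocc ((Sρ.eventually_cofinite_notMem).mono fun v hv => ⟨((ξ.xiLocalChar v).comp (MonoidHom.inl ((cmDatum L 2 (Matrix.of fun i j : Fin 2 => if i.val + j.val + 1 = 2 then (1 : L) else 0)).Local v) ((cmDatum L 1 (Matrix.of fun i j : Fin 1 => if i.val + j.val + 1 = 1 then (1 : L) else 0)).Local v))), (IrrClass.isOpen_ker_comp_inl (F0P3XiLocalCharOpenKernel.isOpen_ker_xiLocalChar L ξ v)), hoff v hv⟩)
  -- off `Sρ`: `θ_v = (η ψ)_v`; hence `θ = η ψ`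
  have hθeq : θ = ξ.η * ξ.ψ :=
    torusCharacter_eq_of_torusLocalComponent_eq_of_not_mem (IsCMField.complexConj L) (Algebra.IsQuadraticExtension.finrank_eq_two _ L)
      (IsCMField.complexConj_ne_one (K := L)) Sρ θ (ξ.η * ξ.ψ) hθ (isAutomorphic_eta_mul_psi ξ)
      fun v hv => torusLocalComponent_eq_of_mk_ofChar_comp_localDet_eq ξ v θ (hk v) ((hπ v).symm.trans (hoff v hv))
  subst hθeq
  intro v
  exact (hπ v).trans ((IrrClass.mk_ofChar_eq_mk_ofChar_iff (hk v) (IrrClass.isOpen_ker_comp_inl (F0P3XiLocalCharOpenKernel.isOpen_ker_xiLocalChar L ξ v))).2 (xiLocalChar_comp_inl ξ v).symm)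

/-! ## §2 The character-packet member as a box [§12.1 p. 171] -/

/-- **`⟦ξ_v|_{U(Φ₂)}⟧ ⊠ ξ_v|_{U(Φ₁)} = ⟦ξ_v⟧`** for any class `c = ⟦ξ_v|_{U(Φ₂)}⟧` and character `χ = ξ_v|_{U(Φ₁)}` (★ (L3χ) + (L4)). [cite: Rogawski1990, §12.1 p. 171]
[cite: BushnellHenniart2006, §9.1] -/
theorem boxChar_eq_mk_xiLocalChar (ξ : OneDimAutRepH L) (v : HeightOneSpectrum (𝓞 ↥(maximalRealSubfield L)))
    {c : IrrClass ((cmDatum L 2 (Matrix.of fun i j : Fin 2 => if i.val + j.val + 1 = 2 then (1 : L) else 0)).Local v)} {χ : ((cmDatum L 1 (Matrix.of fun i j : Fin 1 => if i.val + j.val + 1 = 1 then (1 : L) else 0)).Local v) →* ℂˣ}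
    (hχ : IsOpen (((χ.ker : Subgroup ((cmDatum L 1 (Matrix.of fun i j : Fin 1 => if i.val + j.val + 1 = 1 then (1 : L) else 0)).Local v))) : Set ((cmDatum L 1 (Matrix.of fun i j : Fin 1 => if i.val + j.val + 1 = 1 then (1 : L) else 0)).Local v)))
    (hc : c = IrrClass.mk (SmoothIrrep.ofChar ((ξ.xiLocalChar v).comp (MonoidHom.inl ((cmDatum L 2 (Matrix.of fun i j : Fin 2 => if i.val + j.val + 1 = 2 then (1 : L) else 0)).Local v) ((cmDatum L 1 (Matrix.of fun i j : Fin 1 => if i.val + j.val + 1 = 1 then (1 : L) else 0)).Local v))) (IrrClass.isOpen_ker_comp_inl (F0P3XiLocalCharOpenKernel.isOpen_ker_xiLocalChar L ξ v))))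
    (hχe : χ = ((ξ.xiLocalChar v).comp (MonoidHom.inr ((cmDatum L 2 (Matrix.of fun i j : Fin 2 => if i.val + j.val + 1 = 2 then (1 : L) else 0)).Local v) ((cmDatum L 1 (Matrix.of fun i j : Fin 1 => if i.val + j.val + 1 = 1 then (1 : L) else 0)).Local v)))) :
    IrrClass.boxChar χ hχ c = IrrClass.mk (SmoothIrrep.ofChar (ξ.xiLocalChar v) (F0P3XiLocalCharOpenKernel.isOpen_ker_xiLocalChar L ξ v)) :=
  ((IrrClass.boxChar_eq_boxChar_iff hχ (IrrClass.isOpen_ker_comp_inr (F0P3XiLocalCharOpenKernel.isOpen_ker_xiLocalChar L ξ v))).2 ⟨hc, hχe⟩).trans (IrrClass.mk_ofChar_eq_boxChar (ξ.xiLocalChar v) (F0P3XiLocalCharOpenKernel.isOpen_ker_xiLocalChar L ξ v)).symm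

/-! ## §3 (KR-2) from (KD4-H), (KR-1′), O8a and the ★ `U(1)` line [§13.3 Thms. 13.3.2∕13.3.4∕13.3.5 p. 202] -/

/-- **(KR-2) DERIVED, MEMBER-SET FORM**: kit-generic over the slots `𝔩 𝔞 𝔞H DiscH` and the realising automorphic measures `μ₂, μ₁` of `U(Φ₂)`, `U(Φ₁)`.  Hypotheses: the
IN-∃ construction rows (KD4-H) «every `DiscH`-discrete `H`-packet is realised in `L²_disc(U(Φ₂)) ⊗ L²_disc(U(Φ₁))` (occurring families `π₂`, `χ₁` with
`π₂,v ⊠ χ₁,v ∈ ρ_v`)» and (KR-1′) «an `H_v`-packet containing `⟦ξ_v⟧` is `{⟦ξ_v⟧}`», and the PRINT S organ O8a ★ `PKsaU2Shape L`.  Conclusion: a `DiscH`-discrete `ρ` with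
member sets `{⟦ξ_v⟧}` off the finite set `Sρ` has them at every finite place. [cite: Rogawski1990, §13.3 Thm. 13.3.2, Thm. 13.3.4, Thm. 13.3.5 p. 202, p. 202 ll. 16–18, p. 203]
[cite: PlatonovRapinchuk1994, §7.4 Thm. 7.12 p. 427] -/
theorem memH_loc_eq_singleton_of_KD4H {H' : Matrix (Fin 3) (Fin 3) L}
    {𝔩 : ∀ v : HeightOneSpectrum (𝓞 ↥(maximalRealSubfield L)), LocalPacketKit L H' v} {𝔞 : ArchPacketKit} {𝔞H : ArchPacketKitH 𝔞}
    {DiscH : GlobalPacketH 𝔩 → 𝔞H.PktInfH → Prop}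
    (μ₂ : Measure (adelicGroupData (↥(maximalRealSubfield L)) L (IsCMField.complexConj L) 2 (Matrix.of fun i j : Fin 2 => if i.val + j.val + 1 = 2 then (1 : L) else 0)).automorphicQuotient) [(adelicGroupData (↥(maximalRealSubfield L)) L (IsCMField.complexConj L) 2 (Matrix.of fun i j : Fin 2 => if i.val + j.val + 1 = 2 then (1 : L) else 0)).IsAutomorphicMeasure μ₂]
    (μ₁ : Measure (adelicGroupData (↥(maximalRealSubfield L)) L (IsCMField.complexConj L) 1 (Matrix.of fun i j : Fin 1 => if i.val + j.val + 1 = 1 then (1 : L) else 0)).automorphicQuotient) [(adelicGroupData (↥(maximalRealSubfield L)) L (IsCMField.complexConj L) 1 (Matrix.of fun i j : Fin 1 => if i.val + j.val + 1 = 1 then (1 : L) else 0)).IsAutomorphicMeasure μ₁]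
    (hKD4 : ∀ ρ : SpectralPacketH 𝔩 𝔞 𝔞H DiscH,
      ∃ (π₂ : ∀ v : HeightOneSpectrum (𝓞 ↥(maximalRealSubfield L)), IrrClass ((cmDatum L 2 (Matrix.of fun i j : Fin 2 => if i.val + j.val + 1 = 2 then (1 : L) else 0)).Local v))
        (χ₁ : ∀ v : HeightOneSpectrum (𝓞 ↥(maximalRealSubfield L)), ((cmDatum L 1 (Matrix.of fun i j : Fin 1 => if i.val + j.val + 1 = 1 then (1 : L) else 0)).Local v) →* ℂˣ)
        (hχ₁ : ∀ v : HeightOneSpectrum (𝓞 ↥(maximalRealSubfield L)), IsOpen (((χ₁ v).ker : Subgroup ((cmDatum L 1 (Matrix.of fun i j : Fin 1 => if i.val + j.val + 1 = 1 then (1 : L) else 0)).Local v)) : Set ((cmDatum L 1 (Matrix.of fun i j : Fin 1 => if i.val + j.val + 1 = 1 then (1 : L) else 0)).Local v))),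
        cmOccursInDiscreteSpectrum L 2 (Matrix.of fun i j : Fin 2 => if i.val + j.val + 1 = 2 then (1 : L) else 0) μ₂ π₂ ∧
        cmOccursInDiscreteSpectrum L 1 (Matrix.of fun i j : Fin 1 => if i.val + j.val + 1 = 1 then (1 : L) else 0) μ₁ (fun v => IrrClass.mk (SmoothIrrep.ofChar (χ₁ v) (hχ₁ v))) ∧
        ∀ v : HeightOneSpectrum (𝓞 ↥(maximalRealSubfield L)), IrrClass.boxChar (χ₁ v) (hχ₁ v) (π₂ v) ∈ (𝔩 v).memH (ρ.fin.loc v))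
    (hKR1' : ∀ (ξ : OneDimAutRepH L) (v : HeightOneSpectrum (𝓞 ↥(maximalRealSubfield L))) (r : (𝔩 v).PktH),
      IrrClass.mk (SmoothIrrep.ofChar (ξ.xiLocalChar v) (F0P3XiLocalCharOpenKernel.isOpen_ker_xiLocalChar L ξ v)) ∈ (𝔩 v).memH r →
        (𝔩 v).memH r = {IrrClass.mk (SmoothIrrep.ofChar (ξ.xiLocalChar v) (F0P3XiLocalCharOpenKernel.isOpen_ker_xiLocalChar L ξ v))})
    (hsa : PKsaU2Shape L)
    (ρ : SpectralPacketH 𝔩 𝔞 𝔞H DiscH) (ξ : OneDimAutRepH L) (Sρ : Finset (HeightOneSpectrum (𝓞 ↥(maximalRealSubfield L))))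
    (hoff : ∀ v ∉ Sρ, (𝔩 v).memH (ρ.fin.loc v) = {IrrClass.mk (SmoothIrrep.ofChar (ξ.xiLocalChar v) (F0P3XiLocalCharOpenKernel.isOpen_ker_xiLocalChar L ξ v))})
    (v : HeightOneSpectrum (𝓞 ↥(maximalRealSubfield L))) :
    (𝔩 v).memH (ρ.fin.loc v) = {IrrClass.mk (SmoothIrrep.ofChar (ξ.xiLocalChar v) (F0P3XiLocalCharOpenKernel.isOpen_ker_xiLocalChar L ξ v))} := by
  obtain ⟨π₂, χ₁, hχ₁, hocc₂, hocc₁, hmem⟩ := hKD4 ρ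
  -- off `Sρ` the member `π₂,v ⊠ χ₁,v` lies in `{⟦ξ_v⟧}`: joint rigidity of `⊠`
  have hoff' : ∀ v : HeightOneSpectrum (𝓞 ↥(maximalRealSubfield L)), v ∉ Sρ →
      π₂ v = IrrClass.mk (SmoothIrrep.ofChar ((ξ.xiLocalChar v).comp (MonoidHom.inl ((cmDatum L 2 (Matrix.of fun i j : Fin 2 => if i.val + j.val + 1 = 2 then (1 : L) else 0)).Local v) ((cmDatum L 1 (Matrix.of fun i j : Fin 1 => if i.val + j.val + 1 = 1 then (1 : L) else 0)).Local v))) (IrrClass.isOpen_ker_comp_inl (F0P3XiLocalCharOpenKernel.isOpen_ker_xiLocalChar L ξ v))) ∧ χ₁ v = ((ξ.xiLocalChar v).comp (MonoidHom.inr ((cmDatum L 2 (Matrix.of fun i j : Fin 2 => if i.val + j.val + 1 = 2 then (1 : L) else 0)).Local v) ((cmDatum L 1 (Matrix.of fun i j : Fin 1 => if i.val + j.val + 1 = 1 then (1 : L) else 0)).Local v))) := fun v hv =>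
    IrrClass.eq_of_boxChar_mem_singleton (hχ₁ v) (F0P3XiLocalCharOpenKernel.isOpen_ker_xiLocalChar L ξ v) (hoff v hv ▸ hmem v)
  -- `U(Φ₁)`: the ★ `U(1)` line
  have h₁ : ∀ v : HeightOneSpectrum (𝓞 ↥(maximalRealSubfield L)), χ₁ v = ((ξ.xiLocalChar v).comp (MonoidHom.inr ((cmDatum L 2 (Matrix.of fun i j : Fin 2 => if i.val + j.val + 1 = 2 then (1 : L) else 0)).Local v) ((cmDatum L 1 (Matrix.of fun i j : Fin 1 => if i.val + j.val + 1 = 1 then (1 : L) else 0)).Local v))) :=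
    forall_eq_of_cmOccursInDiscreteSpectrum_of_eventually_eq χ₁ hχ₁ hocc₁ ξ ((Sρ.eventually_cofinite_notMem).mono fun v hv => (hoff' v hv).2)
  -- `U(Φ₂)`: §1 (O8a + torus rigidity)
  have h₂ : ∀ v : HeightOneSpectrum (𝓞 ↥(maximalRealSubfield L)), π₂ v = IrrClass.mk (SmoothIrrep.ofChar ((ξ.xiLocalChar v).comp (MonoidHom.inl ((cmDatum L 2 (Matrix.of fun i j : Fin 2 => if i.val + j.val + 1 = 2 then (1 : L) else 0)).Local v) ((cmDatum L 1 (Matrix.of fun i j : Fin 1 => if i.val + j.val + 1 = 1 then (1 : L) else 0)).Local v))) (IrrClass.isOpen_ker_comp_inl (F0P3XiLocalCharOpenKernel.isOpen_ker_xiLocalChar L ξ v))) :=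
    forall_pi₂_eq_of_pKsaU2Shape_of_forall_not_mem hsa π₂ hocc₂ ξ Sρ fun v hv => (hoff' v hv).1
  -- so `⟦ξ_v⟧ = π₂,v ⊠ χ₁,v ∈ ρ_v` everywhere, and (KR-1′) concludes
  exact hKR1' ξ v (ρ.fin.loc v) (boxChar_eq_mk_xiLocalChar ξ v (hχ₁ v) (h₂ v) (h₁ v) ▸ hmem v)

/-- **(KR-2) DERIVED — THE LEAF ROW TEXT** «a `DiscH`-discrete `H`-packet that is the character `ξ_v` at almost every place is the character packet `ξ` everywhere»
(leaf `F0_P3c_PKtuplePaydown` ED. 2 :192, conclusion token for token), from (KD4-H) + (KR-1′) + O8a; the TIE of glue O6 in the leaf ED. 3 is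
`fun ρ ξ Sρ h => KR2_of_KD4H μ₂ μ₁ hKD4 hKR1' stub_PKsaU2 ρ ξ Sρ h`. [cite: Rogawski1990, §13.3 Thm. 13.3.2, Thm. 13.3.4, Thm. 13.3.5 p. 202, p. 202 ll. 16–18]
[cite: PlatonovRapinchuk1994, §7.4 Thm. 7.12 p. 427] -/
theorem KR2_of_KD4H {H' : Matrix (Fin 3) (Fin 3) L}
    {𝔩 : ∀ v : HeightOneSpectrum (𝓞 ↥(maximalRealSubfield L)), LocalPacketKit L H' v} {𝔞 : ArchPacketKit} {𝔞H : ArchPacketKitH 𝔞}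
    {DiscH : GlobalPacketH 𝔩 → 𝔞H.PktInfH → Prop}
    (μ₂ : Measure (adelicGroupData (↥(maximalRealSubfield L)) L (IsCMField.complexConj L) 2 (Matrix.of fun i j : Fin 2 => if i.val + j.val + 1 = 2 then (1 : L) else 0)).automorphicQuotient) [(adelicGroupData (↥(maximalRealSubfield L)) L (IsCMField.complexConj L) 2 (Matrix.of fun i j : Fin 2 => if i.val + j.val + 1 = 2 then (1 : L) else 0)).IsAutomorphicMeasure μ₂]
    (μ₁ : Measure (adelicGroupData (↥(maximalRealSubfield L)) L (IsCMField.complexConj L) 1 (Matrix.of fun i j : Fin 1 => if i.val + j.val + 1 = 1 then (1 : L) else 0)).automorphicQuotient) [(adelicGroupData (↥(maximalRealSubfield L)) L (IsCMField.complexConj L) 1 (Matrix.of fun i j : Fin 1 => if i.val + j.val + 1 = 1 then (1 : L) else 0)).IsAutomorphicMeasure μ₁]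
    (hKD4 : ∀ ρ : SpectralPacketH 𝔩 𝔞 𝔞H DiscH,
      ∃ (π₂ : ∀ v : HeightOneSpectrum (𝓞 ↥(maximalRealSubfield L)), IrrClass ((cmDatum L 2 (Matrix.of fun i j : Fin 2 => if i.val + j.val + 1 = 2 then (1 : L) else 0)).Local v))
        (χ₁ : ∀ v : HeightOneSpectrum (𝓞 ↥(maximalRealSubfield L)), ((cmDatum L 1 (Matrix.of fun i j : Fin 1 => if i.val + j.val + 1 = 1 then (1 : L) else 0)).Local v) →* ℂˣ)
        (hχ₁ : ∀ v : HeightOneSpectrum (𝓞 ↥(maximalRealSubfield L)), IsOpen (((χ₁ v).ker : Subgroup ((cmDatum L 1 (Matrix.of fun i j : Fin 1 => if i.val + j.val + 1 = 1 then (1 : L) else 0)).Local v)) : Set ((cmDatum L 1 (Matrix.of fun i j : Fin 1 => if i.val + j.val + 1 = 1 then (1 : L) else 0)).Local v))),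
        cmOccursInDiscreteSpectrum L 2 (Matrix.of fun i j : Fin 2 => if i.val + j.val + 1 = 2 then (1 : L) else 0) μ₂ π₂ ∧
        cmOccursInDiscreteSpectrum L 1 (Matrix.of fun i j : Fin 1 => if i.val + j.val + 1 = 1 then (1 : L) else 0) μ₁ (fun v => IrrClass.mk (SmoothIrrep.ofChar (χ₁ v) (hχ₁ v))) ∧
        ∀ v : HeightOneSpectrum (𝓞 ↥(maximalRealSubfield L)), IrrClass.boxChar (χ₁ v) (hχ₁ v) (π₂ v) ∈ (𝔩 v).memH (ρ.fin.loc v))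
    (hKR1' : ∀ (ξ : OneDimAutRepH L) (v : HeightOneSpectrum (𝓞 ↥(maximalRealSubfield L))) (r : (𝔩 v).PktH),
      IrrClass.mk (SmoothIrrep.ofChar (ξ.xiLocalChar v) (F0P3XiLocalCharOpenKernel.isOpen_ker_xiLocalChar L ξ v)) ∈ (𝔩 v).memH r →
        (𝔩 v).memH r = {IrrClass.mk (SmoothIrrep.ofChar (ξ.xiLocalChar v) (F0P3XiLocalCharOpenKernel.isOpen_ker_xiLocalChar L ξ v))})
    (hsa : PKsaU2Shape L) :
    ∀ (ρ : SpectralPacketH 𝔩 𝔞 𝔞H DiscH) (ξ : OneDimAutRepH L) (Sρ : Finset (HeightOneSpectrum (𝓞 ↥(maximalRealSubfield L)))),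
      (∀ v ∉ Sρ, (𝔩 v).memH (ρ.fin.loc v) = {IrrClass.mk (SmoothIrrep.ofChar (ξ.xiLocalChar v) (F0P3XiLocalCharOpenKernel.isOpen_ker_xiLocalChar L ξ v))}) →
        ∀ v : HeightOneSpectrum (𝓞 ↥(maximalRealSubfield L)), (𝔩 v).memH (ρ.fin.loc v) = {IrrClass.mk (SmoothIrrep.ofChar (ξ.xiLocalChar v) (F0P3XiLocalCharOpenKernel.isOpen_ker_xiLocalChar L ξ v))} :=
  fun ρ ξ Sρ hoff v => memH_loc_eq_singleton_of_KD4H μ₂ μ₁ hKD4 hKR1' hsa ρ ξ Sρ hoff v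

/-! ## §4 (ED. 2) (KR-1′) IS NOT A POSIT: it follows from (KD2) «`H_v`-packets meeting are equal» and the signed `H`-shape (PK-SHAPE-H) [§12.1 p. 171; §13.1 p. 199] -/

section KR1prime

open Literature.RepresentationTheory.KonnoKonno2007 (uFormGroup)
-- the T-A law text (KD2) intersects `Finset`s of classes under `open scoped Classical` (as T-A ∕ the leaf do); same instance path here
open scoped Classical

variable {H' : Matrix (Fin 3) (Fin 3) L}
  {𝔩 : ∀ v : HeightOneSpectrum (𝓞 ↥(maximalRealSubfield L)), LocalPacketKit L H' v} {𝔞 : ArchPacketKit} {𝔞H : ArchPacketKitH 𝔞}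
  {DiscH : GlobalPacketH 𝔩 → 𝔞H.PktInfH → Prop}
  {PkX : OneDimAutRepH L → ∀ v : HeightOneSpectrum (𝓞 ↥(maximalRealSubfield L)), CMLocalAPacket L H' v}
  {PkInfX : OneDimAutRepH L → LocalAPacket (GKIrrClass (uFormGroup (Fin 2) (Fin 1)))}
  {χ : OneDimAutRepH L → ∀ v : HeightOneSpectrum (𝓞 ↥(maximalRealSubfield L)),
    ((cmDatum L 2 (Matrix.of fun i j : Fin 2 => if i.val + j.val + 1 = 2 then (1 : L) else 0)).Local v) ×
      ((cmDatum L 1 (Matrix.of fun i j : Fin 1 => if i.val + j.val + 1 = 1 then (1 : L) else 0)).Local v) →* ℂˣ}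
  {hχ : ∀ (ξ : OneDimAutRepH L) (v : HeightOneSpectrum (𝓞 ↥(maximalRealSubfield L))),
    IsOpen (((χ ξ v).ker : Subgroup (((cmDatum L 2 (Matrix.of fun i j : Fin 2 => if i.val + j.val + 1 = 2 then (1 : L) else 0)).Local v) ×
      ((cmDatum L 1 (Matrix.of fun i j : Fin 1 => if i.val + j.val + 1 = 1 then (1 : L) else 0)).Local v))) :
      Set (((cmDatum L 2 (Matrix.of fun i j : Fin 2 => if i.val + j.val + 1 = 2 then (1 : L) else 0)).Local v) ×
        ((cmDatum L 1 (Matrix.of fun i j : Fin 1 => if i.val + j.val + 1 = 1 then (1 : L) else 0)).Local v)))}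
  {εX : OneDimAutRepH L → HeightOneSpectrum (𝓞 ↥(maximalRealSubfield L)) → ℤ} {κHX : OneDimAutRepH L → ℤ}

/-- **(KR-1′) FROM (KD2) + (PK-SHAPE-H)** (kit-generic, any character family `χ`): under the signed `H`-shape `hH` the tuple carries the character packet
`ρ(ξ)_v` with member set `{⟦ℂ_{χ ξ v}⟧}` (★ `memH_rhoXiS_loc`); an `H_v`-packet `r` containing `⟦ℂ_{χ ξ v}⟧` MEETS it, so `r = ρ(ξ)_v` by (KD2) «`H_v`-packets with a common
member are equal» (T-A `TupleKitLawsK2` row (KD2), §12.1: L-packets of `U(2)` are `PGL₂`-orbits, hence disjoint), and `memH r = {⟦ℂ_{χ ξ v}⟧}`.  So the ED. 3 row (KR-1′) need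
not be posited in O1″: it is fed by (KD2) (LAWS) and (PK-SHAPE-H) (a conjunct of the letter). [cite: Rogawski1990, §12.1 pp. 167–168, p. 171; §13.1 p. 199] -/
theorem KR1prime_of_KD2 (hH : SpectralPacketH.XiHPacketsSigned 𝔩 𝔞 𝔞H DiscH PkX PkInfX χ hχ εX κHX)
    (hKD2 : ∀ (v : HeightOneSpectrum (𝓞 ↥(maximalRealSubfield L))) (ρ ρ' : (𝔩 v).PktH), ((𝔩 v).memH ρ ∩ (𝔩 v).memH ρ').Nonempty → ρ = ρ')
    (ξ : OneDimAutRepH L) (v : HeightOneSpectrum (𝓞 ↥(maximalRealSubfield L))) (r : (𝔩 v).PktH)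
    (hmem : IrrClass.mk (SmoothIrrep.ofChar (χ ξ v) (hχ ξ v)) ∈ (𝔩 v).memH r) :
    (𝔩 v).memH r = {IrrClass.mk (SmoothIrrep.ofChar (χ ξ v) (hχ ξ v))} := by
  have hne : ((𝔩 v).memH r ∩ (𝔩 v).memH ((SpectralPacketH.rhoXiS hH ξ).fin.loc v)).Nonempty :=
    ⟨_, Finset.mem_inter.2 ⟨hmem, by rw [SpectralPacketH.memH_rhoXiS_loc]; exact Finset.mem_singleton_self _⟩⟩
  rw [hKD2 v r _ hne, SpectralPacketH.memH_rhoXiS_loc]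

/-- **(KR-2) DERIVED WITHOUT THE (KR-1′) POSIT** — from the signed `H`-shape (PK-SHAPE-H) at the record characters `χ ξ v := ξ_v` (leaf spelling
`(fun ξ v => ξ.xiLocalChar v) (fun ξ v => F0P3XiLocalCharOpenKernel.isOpen_ker_xiLocalChar L ξ v)`), the LAWS row (KD2), the realisation row (KD4-H), and O8a:
§3 `KR2_of_KD4H` with `hKR1'` := §4 `KR1prime_of_KD2`.  TIE for the leaf ED. 3: `fun ρ ξ Sρ h => KR2_of_KD4H_of_KD2 hXiHS hKD2 μ₂ μ₁ hKD4 stub_PKsaU2 ρ ξ Sρ h`.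
[cite: Rogawski1990, §13.3 Thm. 13.3.2, Thm. 13.3.4, Thm. 13.3.5 p. 202, p. 202 ll. 16–18; §12.1 pp. 167–168] [cite: PlatonovRapinchuk1994, §7.4 Thm. 7.12 p. 427] -/
theorem KR2_of_KD4H_of_KD2
    (hH : SpectralPacketH.XiHPacketsSigned 𝔩 𝔞 𝔞H DiscH PkX PkInfX (fun ξ v => ξ.xiLocalChar v)
      (fun ξ v => F0P3XiLocalCharOpenKernel.isOpen_ker_xiLocalChar L ξ v) εX κHX)
    (hKD2 : ∀ (v : HeightOneSpectrum (𝓞 ↥(maximalRealSubfield L))) (ρ ρ' : (𝔩 v).PktH), ((𝔩 v).memH ρ ∩ (𝔩 v).memH ρ').Nonempty → ρ = ρ')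
    (μ₂ : Measure (adelicGroupData (↥(maximalRealSubfield L)) L (IsCMField.complexConj L) 2 (Matrix.of fun i j : Fin 2 => if i.val + j.val + 1 = 2 then (1 : L) else 0)).automorphicQuotient) [(adelicGroupData (↥(maximalRealSubfield L)) L (IsCMField.complexConj L) 2 (Matrix.of fun i j : Fin 2 => if i.val + j.val + 1 = 2 then (1 : L) else 0)).IsAutomorphicMeasure μ₂]
    (μ₁ : Measure (adelicGroupData (↥(maximalRealSubfield L)) L (IsCMField.complexConj L) 1 (Matrix.of fun i j : Fin 1 => if i.val + j.val + 1 = 1 then (1 : L) else 0)).automorphicQuotient) [(adelicGroupData (↥(maximalRealSubfield L)) L (IsCMField.complexConj L) 1 (Matrix.of fun i j : Fin 1 => if i.val + j.val + 1 = 1 then (1 : L) else 0)).IsAutomorphicMeasure μ₁]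
    (hKD4 : ∀ ρ : SpectralPacketH 𝔩 𝔞 𝔞H DiscH,
      ∃ (π₂ : ∀ v : HeightOneSpectrum (𝓞 ↥(maximalRealSubfield L)), IrrClass ((cmDatum L 2 (Matrix.of fun i j : Fin 2 => if i.val + j.val + 1 = 2 then (1 : L) else 0)).Local v))
        (χ₁ : ∀ v : HeightOneSpectrum (𝓞 ↥(maximalRealSubfield L)), ((cmDatum L 1 (Matrix.of fun i j : Fin 1 => if i.val + j.val + 1 = 1 then (1 : L) else 0)).Local v) →* ℂˣ)
        (hχ₁ : ∀ v : HeightOneSpectrum (𝓞 ↥(maximalRealSubfield L)), IsOpen (((χ₁ v).ker : Subgroup ((cmDatum L 1 (Matrix.of fun i j : Fin 1 => if i.val + j.val + 1 = 1 then (1 : L) else 0)).Local v)) : Set ((cmDatum L 1 (Matrix.of fun i j : Fin 1 => if i.val + j.val + 1 = 1 then (1 : L) else 0)).Local v))),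
        cmOccursInDiscreteSpectrum L 2 (Matrix.of fun i j : Fin 2 => if i.val + j.val + 1 = 2 then (1 : L) else 0) μ₂ π₂ ∧
        cmOccursInDiscreteSpectrum L 1 (Matrix.of fun i j : Fin 1 => if i.val + j.val + 1 = 1 then (1 : L) else 0) μ₁ (fun v => IrrClass.mk (SmoothIrrep.ofChar (χ₁ v) (hχ₁ v))) ∧
        ∀ v : HeightOneSpectrum (𝓞 ↥(maximalRealSubfield L)), IrrClass.boxChar (χ₁ v) (hχ₁ v) (π₂ v) ∈ (𝔩 v).memH (ρ.fin.loc v))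
    (hsa : PKsaU2Shape L) :
    ∀ (ρ : SpectralPacketH 𝔩 𝔞 𝔞H DiscH) (ξ : OneDimAutRepH L) (Sρ : Finset (HeightOneSpectrum (𝓞 ↥(maximalRealSubfield L)))),
      (∀ v ∉ Sρ, (𝔩 v).memH (ρ.fin.loc v) = {IrrClass.mk (SmoothIrrep.ofChar (ξ.xiLocalChar v) (F0P3XiLocalCharOpenKernel.isOpen_ker_xiLocalChar L ξ v))}) →
        ∀ v : HeightOneSpectrum (𝓞 ↥(maximalRealSubfield L)), (𝔩 v).memH (ρ.fin.loc v) = {IrrClass.mk (SmoothIrrep.ofChar (ξ.xiLocalChar v) (F0P3XiLocalCharOpenKernel.isOpen_ker_xiLocalChar L ξ v))} :=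
  KR2_of_KD4H μ₂ μ₁ hKD4 (fun ξ v r h => KR1prime_of_KD2 hH hKD2 ξ v r h) hsa

end KR1prime

end Summit.HodgeConjecture.HodgeConjecture.Cruxes.H413.F0P3cPKtupleKR2OfKD4H

end
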